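import Summits.HodgeConjecture.HodgeConjecture.Theorems.Ring2AbelianAllCMAlgebraicCarriersDefs
import Summits.HodgeConjecture.HodgeConjecture.Theorems.VHCAbelianSchemesRoadCompactPencilDesigns
import Summits.HodgeConjecture.HodgeConjecture.Theorems.Ring2DeformCompactPencils
import Summits.HodgeConjecture.HodgeConjecture.Theses.VHCAbelianSchemesRoad
import HarnessLib

/-!
# Ring 2 / AbelianAll (André column) — `HC_AV` FROM `HC_CM` AND CM-ANCHORED TWISTED CARRIERS FOR ALGEBRAIC CLASSES; `HC_AV` FROM PINNED
# TWISTED DESIGNS WITH `HC_CM` IDLE — the rows of PART AB on the cell's named decls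

research route, not a corollary; conditional on HC_CM plus one named minimal statement.

The §AbelianAll implication table (`RING2-MAP.md`) records edges `HC_CM + X ⟹ HC_AV`. PART AA-h (gen 58) landed the row
`X := CMTwistedCarriers` (carriers for ALL rational `(p,p)` classes on CM abelian varieties; `HC_CM` idle because `X` implies it). PART AB
(`VHCAbelianSchemesRoadCompactPencilDesigns`, road side) served ALGEBRAIC classes; this file states its rows on the NAMED decls —
`PadicSemiregularLift.HodgeAbelianVarieties` (`HC_AV`), `RankFourFaces.CMAbelianHodge` (`HC_CM`), the road's binders `ChernCharacterOnBetti`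
(K-C), `TwistedPerfectDoor`, `AndreCMAnchoredPencil` (#21), `AndreAnchoredPencilsAlgebraic` (#22), the node `Ring2.Deform.CompactAbelianPencilVHC`
(André's Remarque-2 input), the class targets `HCAtDim g`, and the nodes of PART AB's definitions file (`CMAlgebraicCarriers 𝒪` /
`CMAlgebraicTwistedCarriers`, `AbelianDesigns 𝒪` / `AbelianTwistedDesigns`):

* §1 **`HC_AV_of_HC_CM_of_cmAlgebraicTwistedCarriers : K-C → TwistedPerfectDoor → #21 → HC_CM → CMAlgebraicTwistedCarriers → HC_AV`** — the
  deliverable shape «`HC_CM → B_min → HC_AV`» with `HC_CM` LOAD-BEARING and `B_min` = twisted carriers for KNOWN ALGEBRAIC classes on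
  polarised CM abelian varieties (`2 ≤ p`, `2p + 4 ≤ n`); door-generic form first. NOT used: K-SR♭∃ / its cells, the curve residual, #22.
* §2 **`compactAbelianPencilVHC_of_door_of_abelianDesigns`** (door ∧ `AbelianDesigns 𝒪` ⟹ `CompactAbelianPencilVHC`),
  **`HC_AV_of_abelianTwistedDesigns : K-C → TwistedPerfectDoor → #21 → #22 → AbelianTwistedDesigns → HC_AV`** and
  `HC_CM_of_abelianTwistedDesigns` (K-C ∧ door ∧ #22 ∧ designs ⟹ `HC_CM`, no #21): on the row `X := AbelianTwistedDesigns` `HC_CM` is IDLE.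
* §3 The lattice of nodes: `CMAnchoredCarriers 𝒪 ⟹ CMAlgebraicCarriers 𝒪 ⟸ AbelianDesigns 𝒪`; `HC_CM ∧ CMAlgebraicCarriers 𝒪 ⟹
  CMAnchoredCarriers 𝒪`, so `CMAnchoredCarriers 𝒪 ⟺ CMAlgebraicCarriers 𝒪` next to `HC_CM`; twisted forms.
* §4 Per dimension, on the class targets: `hcAtDim_of_hcOnClass_cm_double_of_cmAlgebraicTwistedCarrierAt` — `HCAtDim g` ⟸ K-C ∧ door ∧ #21 ∧
  `HCOnClass «CM of dimension 2g»` ∧ twisted carriers for algebraic classes on CM `2g`-folds in codimensions `2 ≤ p ≤ g − 2`; the FOURFOLD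
  row `hcAtDim_four_of_hcOnClass_cm_eight_of_cmAlgebraicTwistedCarrierAt` (ONE cell `(8, 2)`: the first instance of the column).

HONEST: all carrier / design nodes are OPEN, not in print, NOT implied by the Hodge conjecture (no `…_of_HodgeConjecture` companion exists for
them); Lemmes 6.3.1–6.3.3 are REFEREED named facts entering BY NAME as hypotheses (route binders); `HC_CM` is an ARGUMENT in §1, §3, §4 and a
CONCLUSION in §2. Nothing here says any carrier, design, door, `HC_CM`, `HC_AV` or HC holds. References: [cite: Andre1996Motifs, §6.3 Lemmes 6.3.1–6.3.3 and Remarque 2]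
[cite: Bloch1972Semiregularity, Remark (7.5)] [cite: BuchweitzFlenner2003, §5 Thm. 5.1] [cite: Pridham2024Semiregularity, Cor. 2.25 and Rem. 2.27]
[cite: Milne1999, §7 p. 72] [cite: Abdulali1994FamiliesAV, (1.1) and Lemma 6.2].
-/

noncomputable section

open CategoryTheory CategoryTheory.Limits AlgebraicGeometry Topology

namespace Summit.HodgeConjecture.HodgeConjecture.Ring2.AbelianAll

-- the cell's namespace repeats the summit name (`Summit.HodgeConjecture.HodgeConjecture…`), as in every `Ring2*` file
set_option linter.dupNamespace false

open Literature.AlgebraicGeometry Literature.AlgebraicGeometry.Motives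
open Literature.AlgebraicGeometry.HodgeTheory
open Literature.AlgebraicTopology.SingularHomology
open Literature.AlgebraicGeometry.Milne1999 (IsOfCMType CMHodgeHypothesisAt)
open Literature.AlgebraicGeometry.Andre1996 (andre1996_cmAnchoredPencil andre1996_cmHodgeClasses_algebraicallyAnchoredPencils)
open Summit.Ventures.HSemireg (ObjClass LocalVariationalHodgeFor)
open Summit.HodgeConjecture.HodgeConjecture.Theses
open Summit.HodgeConjecture.HodgeConjecture.Ring2.Deform (HC_CM_of_HC_AV CompactAbelianPencilVHC)
open Summit.HodgeConjecture.HodgeConjecture.Ring2.ClassTargets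
open Summit.HodgeConjecture.HodgeConjecture.Ring2.SemiregularRepresentatives (AnchoredCarrierAt PinnedDesignAt
  twistedPerfectDoorVHC_iff_localVariationalHodgeFor forall_hodgeConjectureFor_of_cmAnchoredPencil_of_cmHodge_of_cmAlgebraicCarrierAt
  forall_invariantCyclesHoldFor_compactPencil_of_pinnedDesignAt cmHodgeHypothesisAt_of_anchoredPencils_of_door_of_pinnedDesignAt
  forall_hodgeConjectureFor_of_andre1996_of_door_of_pinnedDesignAt cmAlgebraicCarrierAt_of_pinnedDesignAt
  cmAlgebraicCarrierAt_of_cmHodgeCarrierAt cmHodgeCarrierAt_of_cmHodge_of_cmAlgebraicCarrierAt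
  hcAtDim_of_cmAnchoredPencil_of_cmHodge_of_cmAlgebraicCarrierAt)

/-! ## §1 `HC_CM` load-bearing: `HC_AV` from CM-anchored carriers for ALGEBRAIC classes -/

/-- **`HC_AV` from André's Lemme 6.3.1, the door's local variational Hodge statement, `HC_CM` and CM-ANCHORED `𝒪`-CARRIERS FOR ALGEBRAIC
CLASSES** (door-generic; cell-free; residual-free; `HC_CM` load-bearing). [cite: Andre1996Motifs, §6.3 Lemme 6.3.1 and a)]
[cite: BuchweitzFlenner2003, §5 Thm. 5.1] [cite: Bloch1972Semiregularity, Remark (7.5)] [cite: Milne1999, §7 p. 72] -/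
theorem HC_AV_of_andre1996_of_door_of_HC_CM_of_cmAlgebraicCarriers (h₂₁ : andre1996_cmAnchoredPencil) {𝒪 : ObjClass}
    (hT : LocalVariationalHodgeFor 𝒪) (hCM : RankFourFaces.CMAbelianHodge) (hB : CMAlgebraicCarriers 𝒪) :
    PadicSemiregularLift.HodgeAbelianVarieties :=
  fun A ↦ forall_hodgeConjectureFor_of_cmAnchoredPencil_of_cmHodge_of_cmAlgebraicCarrierAt h₂₁ hT (fun A₀ ↦ hCM A₀)
    (fun n p h2 h4 ↦ hB n p h2 h4) A

/-- **`HC_AV ⟸ K-C ∧ TwistedPerfectDoor ∧ AndreCMAnchoredPencil ∧ HC_CM ∧ CMAlgebraicTwistedCarriers`** — the road's binders BY NAME, `HC_CM` BY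
NAME, and the node of PART AB: the cell's deliverable shape «`HC_CM → B_min → HC_AV`» with `HC_CM` LOAD-BEARING and `B_min` = semiregular
twisted representatives, modulo the `θ`-ray, of KNOWN ALGEBRAIC cycles of codimension `2 ≤ p`, `2p + 4 ≤ n` on polarised CM abelian
`n`-folds. NOT used: the crux K-SR♭∃ / its cells, the curve residual `RaynaudSectionProjective`, André #22.
[cite: Andre1996Motifs, §6.3 Lemme 6.3.1] [cite: Pridham2024Semiregularity, Cor. 2.25 and Rem. 2.27] [cite: Bloch1972Semiregularity, Remark (7.5)]
[cite: Milne1999, §7 p. 72] -/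
theorem HC_AV_of_HC_CM_of_cmAlgebraicTwistedCarriers (hC : VHCAbelianSchemesRoad.ChernCharacterOnBetti)
    (hDoor : VHCAbelianSchemesRoad.TwistedPerfectDoor) (h₂₁ : VHCAbelianSchemesRoad.AndreCMAnchoredPencil)
    (hCM : RankFourFaces.CMAbelianHodge) (hB : CMAlgebraicTwistedCarriers) : PadicSemiregularLift.HodgeAbelianVarieties := by
  obtain ⟨C⟩ := (hC : Nonempty ChernCharacterBetti)
  exact HC_AV_of_andre1996_of_door_of_HC_CM_of_cmAlgebraicCarriers h₂₁
    ((twistedPerfectDoorVHC_iff_localVariationalHodgeFor C _).1 (hDoor C)) hCM (hB C)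

/-! ## §2 `HC_CM` idle: André's Remarque-2 input and `HC_AV` from the pinned designs -/

/-- **Door ∧ `AbelianDesigns 𝒪` ⟹ `CompactAbelianPencilVHC`** — Grothendieck's transport of algebraicity on every compact pencil of abelian
varieties (André's Remarque-2 input, the cell's node) from per-variety designs for algebraic classes. [cite: Andre1996Motifs, §6.3 Remarque 2 (p. 33)]
[cite: Abdulali1994FamiliesAV, (1.1) (p. 1122)] [cite: BuchweitzFlenner2003, §5 Thm. 5.1] -/
theorem compactAbelianPencilVHC_of_door_of_abelianDesigns {𝒪 : ObjClass} (hT : LocalVariationalHodgeFor 𝒪) (hD : AbelianDesigns 𝒪) :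
    CompactAbelianPencilVHC :=
  forall_invariantCyclesHoldFor_compactPencil_of_pinnedDesignAt hT fun n p h2 h4 ↦ hD n p h2 h4

/-- **K-C ∧ TwistedPerfectDoor ∧ AbelianTwistedDesigns ⟹ `CompactAbelianPencilVHC`.** [cite: Andre1996Motifs, §6.3 Remarque 2 (p. 33)]
[cite: Pridham2024Semiregularity, Cor. 2.25 and Rem. 2.27] [cite: Abdulali1994FamiliesAV, (1.1)] -/
theorem compactAbelianPencilVHC_of_abelianTwistedDesigns (hC : VHCAbelianSchemesRoad.ChernCharacterOnBetti)
    (hDoor : VHCAbelianSchemesRoad.TwistedPerfectDoor) (hD : AbelianTwistedDesigns) : CompactAbelianPencilVHC := by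
  obtain ⟨C⟩ := (hC : Nonempty ChernCharacterBetti)
  exact compactAbelianPencilVHC_of_door_of_abelianDesigns ((twistedPerfectDoorVHC_iff_localVariationalHodgeFor C _).1 (hDoor C)) (hD C)

/-- **`HC_CM` AS A CONCLUSION: Lemmes 6.3.2–6.3.3 ∧ door ∧ `AbelianDesigns 𝒪` ⟹ `HC_CM`** (no Lemme 6.3.1). [cite: Andre1996Motifs, Lemmes 6.3.2–6.3.3 and §6.3 b), c)]
[cite: Milne1999, §7 p. 72] [cite: BuchweitzFlenner2003, §5 Thm. 5.1] -/
theorem HC_CM_of_anchoredPencils_of_door_of_abelianDesigns (h₂₂ : andre1996_cmHodgeClasses_algebraicallyAnchoredPencils) {𝒪 : ObjClass}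
    (hT : LocalVariationalHodgeFor 𝒪) (hD : AbelianDesigns 𝒪) : RankFourFaces.CMAbelianHodge :=
  fun B hB hcm ↦ cmHodgeHypothesisAt_of_anchoredPencils_of_door_of_pinnedDesignAt h₂₂ hT (fun n p h2 h4 ↦ hD n p h2 h4) B hB hcm

/-- **`HC_AV` from Lemmes 6.3.1–6.3.3, the door and `AbelianDesigns 𝒪`** (door-generic; `HC_CM` idle). [cite: Andre1996Motifs, §6.3 (pp. 31–33)]
[cite: Milne2020HodgeClassesAV, Rem. 2–3] [cite: Bloch1972Semiregularity, Remark (7.5)] -/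
theorem HC_AV_of_andre1996_of_door_of_abelianDesigns (h₂₁ : andre1996_cmAnchoredPencil)
    (h₂₂ : andre1996_cmHodgeClasses_algebraicallyAnchoredPencils) {𝒪 : ObjClass} (hT : LocalVariationalHodgeFor 𝒪) (hD : AbelianDesigns 𝒪) :
    PadicSemiregularLift.HodgeAbelianVarieties :=
  fun A ↦ forall_hodgeConjectureFor_of_andre1996_of_door_of_pinnedDesignAt h₂₁ h₂₂ hT (fun n p h2 h4 ↦ hD n p h2 h4) A

/-- **`HC_AV ⟸ K-C ∧ TwistedPerfectDoor ∧ AndreCMAnchoredPencil ∧ AndreAnchoredPencilsAlgebraic ∧ AbelianTwistedDesigns`** — the road's binders BY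
NAME and the designs node: compared with the road's `Assembly` (K-C → crux → door → Raynaud → #21 → #22 → `HC_AV`) the crux K-SR♭∃ and the
curve residual are replaced by per-variety twisted designs for ALGEBRAIC classes. `HC_CM` IDLE (it follows: `HC_CM_of_abelianTwistedDesigns`).
[cite: Andre1996Motifs, §6.3 Lemmes 6.3.1–6.3.3 and Remarque 2] [cite: Pridham2024Semiregularity, Cor. 2.25 and Rem. 2.27]
[cite: Bloch1972Semiregularity, Remark (7.5)] -/
theorem HC_AV_of_abelianTwistedDesigns (hC : VHCAbelianSchemesRoad.ChernCharacterOnBetti) (hDoor : VHCAbelianSchemesRoad.TwistedPerfectDoor)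
    (h₂₁ : VHCAbelianSchemesRoad.AndreCMAnchoredPencil) (h₂₂ : VHCAbelianSchemesRoad.AndreAnchoredPencilsAlgebraic)
    (hD : AbelianTwistedDesigns) : PadicSemiregularLift.HodgeAbelianVarieties := by
  obtain ⟨C⟩ := (hC : Nonempty ChernCharacterBetti)
  exact HC_AV_of_andre1996_of_door_of_abelianDesigns h₂₁ h₂₂ ((twistedPerfectDoorVHC_iff_localVariationalHodgeFor C _).1 (hDoor C)) (hD C)

/-- **`HC_CM ⟸ K-C ∧ TwistedPerfectDoor ∧ AndreAnchoredPencilsAlgebraic ∧ AbelianTwistedDesigns`** (no #21): on the designs row `HC_CM` is a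
conclusion. [cite: Andre1996Motifs, Lemmes 6.3.2–6.3.3] [cite: Pridham2024Semiregularity, Cor. 2.25 and Rem. 2.27] [cite: Milne1999, §7 p. 72] -/
theorem HC_CM_of_abelianTwistedDesigns (hC : VHCAbelianSchemesRoad.ChernCharacterOnBetti) (hDoor : VHCAbelianSchemesRoad.TwistedPerfectDoor)
    (h₂₂ : VHCAbelianSchemesRoad.AndreAnchoredPencilsAlgebraic) (hD : AbelianTwistedDesigns) : RankFourFaces.CMAbelianHodge := by
  obtain ⟨C⟩ := (hC : Nonempty ChernCharacterBetti)
  exact HC_CM_of_anchoredPencils_of_door_of_abelianDesigns h₂₂ ((twistedPerfectDoorVHC_iff_localVariationalHodgeFor C _).1 (hDoor C)) (hD C)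

/-! ## §3 The lattice of nodes -/

/-- `CMAnchoredCarriers 𝒪 ⟹ CMAlgebraicCarriers 𝒪` (algebraic classes are of type `(p,p)` on the anchor). [cite: Bloch1972Semiregularity, Remark (7.5)]
[cite: VoisinHodgeI2002, §11.3 Prop. 11.20] -/
theorem cmAlgebraicCarriers_of_cmAnchoredCarriers {𝒪 : ObjClass} (h : CMAnchoredCarriers 𝒪) : CMAlgebraicCarriers 𝒪 :=
  fun n p h2 h4 ↦ cmAlgebraicCarrierAt_of_cmHodgeCarrierAt (h n p h2 h4)

/-- `AbelianDesigns 𝒪 ⟹ CMAlgebraicCarriers 𝒪` (restriction to CM anchors; `2p + 4 ≤ n` implies `p + 2 ≤ n`). [cite: Bloch1972Semiregularity, Remark (7.5)]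
[cite: Milne1999, §7 p. 72] -/
theorem cmAlgebraicCarriers_of_abelianDesigns {𝒪 : ObjClass} (h : AbelianDesigns 𝒪) : CMAlgebraicCarriers 𝒪 :=
  fun n p h2 h4 ↦ cmAlgebraicCarrierAt_of_pinnedDesignAt (h n p h2 (by omega))

/-- **`HC_CM ∧ CMAlgebraicCarriers 𝒪 ⟹ CMAnchoredCarriers 𝒪`** (at a CM anchor every rational `(p,p)` class is algebraic by `HC_CM`).
[cite: Milne1999, §7 p. 72] [cite: Bloch1972Semiregularity, Remark (7.5)] -/
theorem cmAnchoredCarriers_of_HC_CM_of_cmAlgebraicCarriers (hCM : RankFourFaces.CMAbelianHodge) {𝒪 : ObjClass} (h : CMAlgebraicCarriers 𝒪) :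
    CMAnchoredCarriers 𝒪 :=
  fun n p h2 h4 ↦ cmHodgeCarrierAt_of_cmHodge_of_cmAlgebraicCarrierAt (fun A₀ _ ↦ hCM A₀) (h n p h2 h4)

/-- **Next to `HC_CM` the two CM carrier nodes coincide.** [cite: Milne1999, §7 p. 72] [cite: Bloch1972Semiregularity, Remark (7.5)] -/
theorem cmAnchoredCarriers_iff_cmAlgebraicCarriers_of_HC_CM (hCM : RankFourFaces.CMAbelianHodge) {𝒪 : ObjClass} :
    CMAnchoredCarriers 𝒪 ↔ CMAlgebraicCarriers 𝒪 :=
  ⟨cmAlgebraicCarriers_of_cmAnchoredCarriers, cmAnchoredCarriers_of_HC_CM_of_cmAlgebraicCarriers hCM⟩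

/-- Twisted forms: `CMTwistedCarriers ⟹ CMAlgebraicTwistedCarriers ⟸ AbelianTwistedDesigns`. [cite: Bloch1972Semiregularity, Remark (7.5)]
[cite: Markman2025SecantWeil, §7.3] -/
theorem cmAlgebraicTwistedCarriers_of_cmTwistedCarriers_or_abelianTwistedDesigns (h : CMTwistedCarriers ∨ AbelianTwistedDesigns) :
    CMAlgebraicTwistedCarriers := by
  rcases h with h | h
  · exact fun C ↦ cmAlgebraicCarriers_of_cmAnchoredCarriers (h C)
  · exact fun C ↦ cmAlgebraicCarriers_of_abelianDesigns (h C)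

/-- Twisted form: next to `HC_CM`, `CMTwistedCarriers ⟺ CMAlgebraicTwistedCarriers`. [cite: Milne1999, §7 p. 72] [cite: Markman2025SecantWeil, §7.3] -/
theorem cmTwistedCarriers_iff_cmAlgebraicTwistedCarriers_of_HC_CM (hCM : RankFourFaces.CMAbelianHodge) :
    CMTwistedCarriers ↔ CMAlgebraicTwistedCarriers :=
  ⟨fun h C ↦ cmAlgebraicCarriers_of_cmAnchoredCarriers (h C), fun h C ↦ cmAnchoredCarriers_of_HC_CM_of_cmAlgebraicCarriers hCM (h C)⟩

/-! ## §4 Per dimension, on the class targets -/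

/-- **`HCAtDim g` ⟸ K-C ∧ TwistedPerfectDoor ∧ #21 ∧ «HC on CM abelian varieties of dimension `2g`» ∧ twisted carriers for ALGEBRAIC classes of
codimension `2 ≤ p ≤ g − 2` on polarised CM abelian `2g`-folds** (every `C`). [cite: Andre1996Motifs, Lemme 6.3.1 (p. 31) and §6.3 a) (p. 33)]
[cite: Pridham2024Semiregularity, Cor. 2.25 and Rem. 2.27] [cite: Bloch1972Semiregularity, Remark (7.5)] -/
theorem hcAtDim_of_hcOnClass_cm_double_of_cmAlgebraicTwistedCarrierAt (g : ℕ) (hC : VHCAbelianSchemesRoad.ChernCharacterOnBetti)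
    (hDoor : VHCAbelianSchemesRoad.TwistedPerfectDoor) (h₂₁ : VHCAbelianSchemesRoad.AndreCMAnchoredPencil)
    (hCM : HCOnClass fun A₀ ↦ A₀.dim = 2 * g ∧ IsOfCMType A₀)
    (hcar : ∀ (C : ChernCharacterBetti) (p : ℕ), 2 ≤ p → p + 2 ≤ g →
      AnchoredCarrierAt (twistedReflexiveClass C
        (fun n X₀ I E => Summit.Ventures.HSemireg.gluableSigmaAdmissible n X₀ I E ∨
          Literature.AlgebraicGeometry.HodgeTheory.bfSingleAdmissible n X₀ I E)) (2 * g) p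
        (cmPolarisedAnchor (2 * g)) (algebraicServedClasses p)) :
    HCAtDim g := by
  obtain ⟨C⟩ := (hC : Nonempty ChernCharacterBetti)
  exact hcAtDim_of_cmAnchoredPencil_of_cmHodge_of_cmAlgebraicCarrierAt g h₂₁
    ((twistedPerfectDoorVHC_iff_localVariationalHodgeFor C _).1 (hDoor C)) (fun A₀ hd _ hcm ↦ hCM A₀ ⟨hd, hcm⟩)
    fun p hp2 hpg ↦ hcar C p hp2 hpg

/-- **THE FOURFOLD ROW, ONE CELL: `HCAtDim 4` ⟸ K-C ∧ TwistedPerfectDoor ∧ #21 ∧ «HC on CM abelian 8-folds» ∧ twisted carriers for ALGEBRAIC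
`(2,2)`-classes on polarised CM abelian 8-folds** (every `C`) — the first instance of the column as a find-the-sheaf problem for known
2-cycles on CM abelian 8-folds (fact-free; abelian fourfolds are also `HCUpToDim 5` modulo Markman 2025, UNREFEREED).
[cite: Andre1996Motifs, Lemme 6.3.1 (p. 31)] [cite: Bloch1972Semiregularity, Remark (7.5)] [cite: MoonenZarhin1999, Thm. 0.1] -/
theorem hcAtDim_four_of_hcOnClass_cm_eight_of_cmAlgebraicTwistedCarrierAt (hC : VHCAbelianSchemesRoad.ChernCharacterOnBetti)
    (hDoor : VHCAbelianSchemesRoad.TwistedPerfectDoor) (h₂₁ : VHCAbelianSchemesRoad.AndreCMAnchoredPencil)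
    (hCM : HCOnClass fun A₀ ↦ A₀.dim = 8 ∧ IsOfCMType A₀)
    (hcar : ∀ C : ChernCharacterBetti,
      AnchoredCarrierAt (twistedReflexiveClass C
        (fun n X₀ I E => Summit.Ventures.HSemireg.gluableSigmaAdmissible n X₀ I E ∨
          Literature.AlgebraicGeometry.HodgeTheory.bfSingleAdmissible n X₀ I E)) 8 2
        (cmPolarisedAnchor 8) (algebraicServedClasses 2)) :
    HCAtDim 4 := by
  refine hcAtDim_of_hcOnClass_cm_double_of_cmAlgebraicTwistedCarrierAt 4 hC hDoor h₂₁ (fun A₀ h ↦ hCM A₀ h) fun C p hp2 hp4 ↦ ?_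
  obtain rfl : p = 2 := by omega
  exact hcar C

end Summit.HodgeConjecture.HodgeConjecture.Ring2.AbelianAll

end
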